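import Mathlib
import Literature.AlgebraicGeometry.HyperbolicPolynomials.SpectrahedralShadow
import Summits.ValiantsHypothesis.ValiantsHypothesis.Theorems.PermanentalConesPermanentalConeHardShadowSlackDuality

/-!
# GPT slack factorisation from a lifted-LMI description (tool stub of `PermanentalConeHard`)

Support file for the crux
`Summit.ValiantsHypothesis.ValiantsHypothesis.Theses.PermanentalCones.PermanentalConeHard`
(item `stmt-ValiantsHypothesis-8654`), line `registered`
(`Cruxes/PermanentalConeHard/Lines/birth.lean`), stub `stub_shadowSlackFactor`.

**Statement.** If `K ⊆ ℝⁿ` has a lifted-LMI description of size `m`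
(`IsSpectrahedralShadowOfSize K m`: `x ∈ K ↔ ∃ y, A (x, y) + B ⪰ 0` with `m × m` real matrices)
and `0 ∈ K`, then for any family of points `xs i ∈ K` and any family of linear functionals `ls k`
nonnegative on `K`, the slack matrix `(ls k (xs i))_{i,k}` factors through the cone of `m × m`
positive semidefinite matrices: `ls k (xs i) = tr (U i * V k)` with `U i, V k ⪰ 0`.  This is the
"lift ⇒ factorisation" half of Yannakakis' principle for semidefinite lifts (Gouveia–Parrilo–Thomas,
*Lifts of convex sets and cone factorizations*, Thm 1; Fawzi–Gouveia–Parrilo–Robinson–Thomas,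
*Positive semidefinite rank*, §2–3), proved here from scratch; the index types `ι, κ` are
arbitrary and `m = 0` is covered uniformly.

**Proof (finite-dimensional conic duality after facial reduction).**  Write `M v := A v + B`
(affine in `v = (x, y)`), `Feas := {v | M v ⪰ 0}` and, for a fixed `k`, `φ v := ls k v.1`, a linear
functional that is `≥ 0` on `Feas` and vanishes at the feasible point `v₀ = (0, y₀)`.  The heart is
`exists_dual_multiplier`: `φ v = tr (M v * Λ)` on `Feas` for some `Λ ⪰ 0`; then
`U i := M (xs i, y i)` and `V k := Λ_k`.
* *Facial reduction* (`exists_minFace`).  Pick `v⋆ ∈ Feas` whose kernel `N := ker (M v⋆)` has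
  minimal dimension; a midpoint argument (`ker (P + Q) ⊆ ker P ∩ ker Q` for `P, Q ⪰ 0`) shows
  `N ⊆ ker (M v)` for all `v ∈ Feas`.  Put `L := {v | M v symmetric, N ⊆ ker (M v)}` (closed under
  affine combinations, `Feas ⊆ L`); `ℝᵐ = N + range (M v⋆)` and the form of `M v⋆` is positive on
  `range (M v⋆) ∖ 0`.
* *Separation.*  In `E := Mat_m(ℝ) × ℝ` the set
  `𝒜 := {(Y, t) | ∃ v ∈ L, (∀ b ∈ range (M v⋆) ∖ 0, bᵀ (M v − Y) b > 0) ∧ φ v < t}` is convex and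
  open, misses `(0, 0)` (such a `v` would be feasible with `φ v < 0`) and contains `(0, φ v⋆ + 1)`;
  geometric Hahn–Banach (`ShadowSlack.exists_linear_lt`) yields a linear `Lf` with `Lf Y < t` on `𝒜`.
* *Reading off the multiplier.*  `Lf ≤ 0` on matrices with nonpositive quadratic form, so
  `Lf Y = tr (Y * Λ)` with `Λ ⪰ 0` (`ShadowSlack.exists_psd_repr`); letting `ε → 0` in
  `(M v − ε • 1, φ v + ε) ∈ 𝒜` gives `Lf (M v) ≤ φ v` on `L`, with equality at `v₀`
  (`Lf (M v₀) ≥ 0`), and an affine function `≥ 0` on the affine space `L` vanishing at a point of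
  `L` vanishes on `L`: `φ v = Lf (M v) = tr (M v * Λ)` on `L ⊇ Feas`.
-/

set_option linter.dupNamespace false

namespace Summit.ValiantsHypothesis.ValiantsHypothesis.Theorems.PermanentalConesPermanentalConeHard

open Literature.AlgebraicGeometry.HyperbolicPolynomials
open scoped Matrix
open ShadowSlack

section Duality

variable {m : ℕ} {P : Type*} [AddCommGroup P] [Module ℝ P]

/-- `A (a v₁ + b v₂) + B = a (A v₁ + B) + b (A v₂ + B)` for `a + b = 1`. -/
private theorem affineComb_eq (A : P →ₗ[ℝ] Matrix (Fin m) (Fin m) ℝ) (B : Matrix (Fin m) (Fin m) ℝ)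
    {a b : ℝ} (hab : a + b = 1) (v₁ v₂ : P) :
    A (a • v₁ + b • v₂) + B = a • (A v₁ + B) + b • (A v₂ + B) := by
  have hB : B = a • B + b • B := by rw [← add_smul, hab, one_smul]
  conv_lhs => rw [hB]
  simp only [map_add, map_smul, smul_add]
  abel

/-- **Facial reduction.**  Some feasible point `vs` has a matrix with kernel of minimal dimension,
and then every feasible matrix kills `ker (A vs + B)` (midpoint argument). -/
private theorem exists_minFace (A : P →ₗ[ℝ] Matrix (Fin m) (Fin m) ℝ) (B : Matrix (Fin m) (Fin m) ℝ)
    {v₀ : P} (hv₀ : (A v₀ + B).PosSemidef) :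
    ∃ vs, (A vs + B).PosSemidef ∧
      ∀ v, (A v + B).PosSemidef → ∀ a, (A vs + B) *ᵥ a = 0 → (A v + B) *ᵥ a = 0 := by
  classical
  obtain ⟨vs, hvs, hmin⟩ : ∃ vs, (A vs + B).PosSemidef ∧ ∀ v, (A v + B).PosSemidef →
      Module.finrank ℝ (LinearMap.ker (A vs + B).mulVecLin) ≤
        Module.finrank ℝ (LinearMap.ker (A v + B).mulVecLin) := by
    let d : P → ℕ := fun v => Module.finrank ℝ (LinearMap.ker (A v + B).mulVecLin)
    exact ⟨Function.argminOn d {v | (A v + B).PosSemidef} ⟨v₀, hv₀⟩,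
      Function.argminOn_mem d {v | (A v + B).PosSemidef} ⟨v₀, hv₀⟩,
      fun v hv => Function.argminOn_le d {v | (A v + B).PosSemidef} hv⟩
  refine ⟨vs, hvs, fun v hv a ha => ?_⟩
  have h2 : (1 / 2 : ℝ) + 1 / 2 = 1 := by norm_num
  have hMw := affineComb_eq A B h2 vs v
  have hpsd1 : ((1 / 2 : ℝ) • (A vs + B)).PosSemidef := hvs.smul (by norm_num)
  have hpsd2 : ((1 / 2 : ℝ) • (A v + B)).PosSemidef := hv.smul (by norm_num)
  have hwF : (A ((1 / 2 : ℝ) • vs + (1 / 2 : ℝ) • v) + B).PosSemidef := by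
    rw [hMw]
    exact hpsd1.add hpsd2
  have hle : LinearMap.ker (A ((1 / 2 : ℝ) • vs + (1 / 2 : ℝ) • v) + B).mulVecLin ≤
      LinearMap.ker (A vs + B).mulVecLin := by
    intro x hx
    rw [LinearMap.mem_ker, Matrix.mulVecLin_apply] at hx ⊢
    rw [hMw] at hx
    have h1 := (mulVec_eq_zero_of_add hpsd1 hpsd2 hx).1
    rw [Matrix.smul_mulVec] at h1
    exact (smul_eq_zero.1 h1).resolve_left (by norm_num)
  have heq := Submodule.eq_of_le_of_finrank_le hle (hmin _ hwF)
  have hx : a ∈ LinearMap.ker (A ((1 / 2 : ℝ) • vs + (1 / 2 : ℝ) • v) + B).mulVecLin := by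
    rw [heq, LinearMap.mem_ker, Matrix.mulVecLin_apply]
    exact ha
  rw [LinearMap.mem_ker, Matrix.mulVecLin_apply, hMw] at hx
  have h1 := (mulVec_eq_zero_of_add hpsd1 hpsd2 hx).2
  rw [Matrix.smul_mulVec] at h1
  exact (smul_eq_zero.1 h1).resolve_left (by norm_num)

/-- **Dual multiplier for a linear functional nonnegative on a lifted LMI set.**  If `φ` is
linear, `φ v ≥ 0` whenever `A v + B ⪰ 0`, and `φ v₀ = 0` at some feasible `v₀`, then there is
`Λ ⪰ 0` with `φ v = tr ((A v + B) * Λ)` for every feasible `v`. -/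
theorem exists_dual_multiplier (A : P →ₗ[ℝ] Matrix (Fin m) (Fin m) ℝ)
    (B : Matrix (Fin m) (Fin m) ℝ) (φ : P →ₗ[ℝ] ℝ) (hφ : ∀ v, (A v + B).PosSemidef → 0 ≤ φ v)
    {v₀ : P} (hv₀ : (A v₀ + B).PosSemidef) (hφ₀ : φ v₀ = 0) :
    ∃ Λ : Matrix (Fin m) (Fin m) ℝ, Λ.PosSemidef ∧
      ∀ v, (A v + B).PosSemidef → φ v = Matrix.trace ((A v + B) * Λ) := by
  classical
  /- Step 1: facial reduction. -/
  obtain ⟨vs, hvs, hker⟩ := exists_minFace A B hv₀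
  /- Step 2: the reduced affine space `L` and the face-relative positivity sets `O X`. -/
  obtain ⟨L, hL⟩ : ∃ L : P → Prop, ∀ v, L v ↔
      ((A v + B).IsHermitian ∧ ∀ a, (A vs + B) *ᵥ a = 0 → (A v + B) *ᵥ a = 0) :=
    ⟨_, fun _ => Iff.rfl⟩
  have hLaff : ∀ v₁ v₂ (a b : ℝ), a + b = 1 → L v₁ → L v₂ → L (a • v₁ + b • v₂) := by
    intro v₁ v₂ a b hab h₁ h₂
    rw [hL] at h₁ h₂ ⊢
    rw [affineComb_eq A B hab]
    refine ⟨(h₁.1.smul (IsSelfAdjoint.all a)).add (h₂.1.smul (IsSelfAdjoint.all b)),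
      fun u hu => ?_⟩
    rw [Matrix.add_mulVec, Matrix.smul_mulVec, Matrix.smul_mulVec, h₁.2 u hu, h₂.2 u hu,
      smul_zero, smul_zero, add_zero]
  have hLfeas : ∀ v, (A v + B).PosSemidef → L v := fun v hv => (hL v).2 ⟨hv.1, hker v hv⟩
  obtain ⟨O, hO, hOopen⟩ : ∃ O : Matrix (Fin m) (Fin m) ℝ → Set (Matrix (Fin m) (Fin m) ℝ),
      (∀ X Y, Y ∈ O X ↔
        ∀ c, (A vs + B) *ᵥ c ≠ 0 → 0 < ((A vs + B) *ᵥ c) ⬝ᵥ ((X - Y) *ᵥ ((A vs + B) *ᵥ c))) ∧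
      ∀ X, IsOpen (O X) :=
    ⟨fun X => {Y | ∀ c, (A vs + B) *ᵥ c ≠ 0 →
        0 < ((A vs + B) *ᵥ c) ⬝ᵥ ((X - Y) *ᵥ ((A vs + B) *ᵥ c))},
      fun _ _ => Iff.rfl, fun X => isOpen_setOf_facePos (A vs + B) X⟩
  /- Step 3: the open convex set `𝒜 ⊆ Mat × ℝ`. -/
  obtain ⟨𝒜, h𝒜⟩ : ∃ 𝒜 : Set (Matrix (Fin m) (Fin m) ℝ × ℝ),
      𝒜 = ⋃ v, ⋃ (_ : L v), O (A v + B) ×ˢ Set.Ioi (φ v) := ⟨_, rfl⟩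
  have hmem : ∀ Y t, (Y, t) ∈ 𝒜 ↔ ∃ v, L v ∧ Y ∈ O (A v + B) ∧ φ v < t := by
    intro Y t
    rw [h𝒜]
    simp only [Set.mem_iUnion, Set.mem_prod, Set.mem_Ioi, exists_prop]
  have hopen : IsOpen 𝒜 := by
    rw [h𝒜]
    exact isOpen_iUnion fun v => isOpen_iUnion fun _ => (hOopen _).prod isOpen_Ioi
  have hconv : Convex ℝ 𝒜 := by
    rintro ⟨Y₁, t₁⟩ h₁ ⟨Y₂, t₂⟩ h₂ a b ha hb hab
    rw [hmem] at h₁ h₂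
    obtain ⟨v₁, hL₁, hO₁, hφ₁⟩ := h₁
    obtain ⟨v₂, hL₂, hO₂, hφ₂⟩ := h₂
    rw [hO] at hO₁ hO₂
    show (a • Y₁ + b • Y₂, a • t₁ + b • t₂) ∈ 𝒜
    rw [hmem]
    refine ⟨a • v₁ + b • v₂, hLaff v₁ v₂ a b hab hL₁ hL₂, ?_, ?_⟩
    · rw [hO]
      intro c hc
      have hmat : A (a • v₁ + b • v₂) + B - (a • Y₁ + b • Y₂) =
          a • (A v₁ + B - Y₁) + b • (A v₂ + B - Y₂) := by
        rw [affineComb_eq A B hab, smul_sub, smul_sub]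
        abel
      rw [hmat, quadForm_add_smul]
      exact convexComb_pos ha hb hab (hO₁ c hc) (hO₂ c hc)
    · rw [map_add, map_smul, map_smul, smul_eq_mul, smul_eq_mul, smul_eq_mul, smul_eq_mul]
      exact convexComb_lt ha hb hab hφ₁ hφ₂
  /- `(0, 0) ∉ 𝒜`: a witness `v` would be feasible with `φ v < 0`. -/
  have h00 : ((0 : Matrix (Fin m) (Fin m) ℝ), (0 : ℝ)) ∉ 𝒜 := by
    rw [hmem]
    rintro ⟨v, hLv, hOv, hφv⟩
    rw [hL] at hLv
    rw [hO] at hOv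
    simp only [sub_zero] at hOv
    have hpsd : (A v + B).PosSemidef := by
      refine Matrix.PosSemidef.of_dotProduct_mulVec_nonneg hLv.1 fun u => ?_
      rw [star_trivial]
      obtain ⟨a, c, ha, rfl⟩ := exists_ker_add_range hvs.1 u
      rw [quadForm_add_of_mulVec_eq_zero hLv.1 (hLv.2 a ha)]
      by_cases hc : (A vs + B) *ᵥ c = 0
      · rw [hc, zero_dotProduct]
      · exact (hOv c hc).le
    linarith [hφ v hpsd]
  /- Points of `𝒜` above `vs`: `(s • Nn, φ vs + 1)` for `Nn` with nonpositive form, `s ≥ 0`. -/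
  have ht₀ : 0 < φ vs + 1 := by linarith [hφ vs hvs]
  have hmemD : ∀ Nn : Matrix (Fin m) (Fin m) ℝ, (∀ u, u ⬝ᵥ (Nn *ᵥ u) ≤ 0) →
      ∀ s : ℝ, 0 ≤ s → (s • Nn, φ vs + 1) ∈ 𝒜 := by
    intro Nn hNn s hs
    rw [hmem]
    refine ⟨vs, hLfeas vs hvs, ?_, by linarith⟩
    rw [hO]
    intro c hc
    rw [Matrix.sub_mulVec, dotProduct_sub, Matrix.smul_mulVec, dotProduct_smul, smul_eq_mul]
    have h1 := quadForm_pos_on_range hvs hc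
    have h2 := mul_nonneg hs (neg_nonneg.2 (hNn ((A vs + B) *ᵥ c)))
    linarith
  have h0t : ((0 : Matrix (Fin m) (Fin m) ℝ), φ vs + 1) ∈ 𝒜 := by
    simpa using hmemD 0 (fun u => by simp) 0 le_rfl
  /- Step 4: separation and the properties of the separating functional. -/
  obtain ⟨Lf, hLf⟩ := exists_linear_lt hconv hopen h00 ht₀ h0t
  have hD : ∀ Nn : Matrix (Fin m) (Fin m) ℝ, (∀ u, u ⬝ᵥ (Nn *ᵥ u) ≤ 0) → Lf Nn ≤ 0 := by
    intro Nn hNn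
    by_contra hpos
    rw [not_le] at hpos
    have h1 := hLf _ _ (hmemD Nn hNn ((φ vs + 1) / Lf Nn) (div_nonneg ht₀.le hpos.le))
    rw [map_smul, smul_eq_mul, div_mul_cancel₀ _ hpos.ne'] at h1
    exact lt_irrefl _ h1
  have hεmem : ∀ v, L v → ∀ ε : ℝ, 0 < ε →
      (A v + B - ε • (1 : Matrix (Fin m) (Fin m) ℝ), φ v + ε) ∈ 𝒜 := by
    intro v hLv ε hε
    rw [hmem]
    refine ⟨v, hLv, ?_, by linarith⟩
    rw [hO]
    intro c hc
    rw [sub_sub_cancel, Matrix.smul_mulVec, Matrix.one_mulVec, dotProduct_smul, smul_eq_mul]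
    exact mul_pos hε (dotProduct_self_pos_of_ne_zero hc)
  have hineq : ∀ v, L v → Lf (A v + B) ≤ φ v := by
    intro v hLv
    have key : ∀ ε : ℝ, 0 < ε → Lf (A v + B) - φ v < ε * (Lf 1 + 1) := by
      intro ε hε
      have h1 := hLf _ _ (hεmem v hLv ε hε)
      rw [map_sub, map_smul, smul_eq_mul] at h1
      linarith
    have h2 := nonpos_of_forall_pos_lt_mul key
    linarith
  have hLf₀ : 0 ≤ Lf (A v₀ + B) := by
    have h1 := hD (-(A v₀ + B)) fun u => by
      rw [Matrix.neg_mulVec, dotProduct_neg]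
      exact neg_nonpos.2 (quadForm_nonneg hv₀ u)
    rwa [map_neg, neg_nonpos] at h1
  /- `φ = Lf ∘ M` on the affine space `L`. -/
  have heqL : ∀ v, L v → φ v = Lf (A v + B) := by
    intro v hLv
    have h1 := hineq v hLv
    have h2 := hineq _ (hLaff v₀ v 2 (-1) (by norm_num) (hLfeas v₀ hv₀) hLv)
    rw [affineComb_eq A B (by norm_num : (2 : ℝ) + -1 = 1)] at h2
    have e1 : Lf ((2 : ℝ) • (A v₀ + B) + (-1 : ℝ) • (A v + B)) =
        2 * Lf (A v₀ + B) + (-1) * Lf (A v + B) := by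
      rw [map_add, map_smul, map_smul, smul_eq_mul, smul_eq_mul]
    have e2 : φ ((2 : ℝ) • v₀ + (-1 : ℝ) • v) = 2 * φ v₀ + (-1) * φ v := by
      rw [map_add, map_smul, map_smul, smul_eq_mul, smul_eq_mul]
    rw [e1, e2, hφ₀] at h2
    linarith
  /- Step 5: the multiplier matrix. -/
  obtain ⟨Λ, hΛpsd, hΛtr⟩ := exists_psd_repr Lf hD
  exact ⟨Λ, hΛpsd, fun v hv => by rw [heqL v (hLfeas v hv), hΛtr]⟩

end Duality

/-- **TOOL (GPT factorisation from a lifted-LMI description).**  If `K ⊆ ℝ^n` has a lifted-LMI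
description of size `m` and contains `0`, then for any points `xs i ∈ K` and any linear functionals
`ls k` nonnegative on `K` the slack matrix `(ls k (xs i))` has a positive-semidefinite
factorisation of size `m`: `ls k (xs i) = tr (U i * V k)` with `U i, V k ⪰ 0`
(Gouveia–Parrilo–Thomas, Thm 1, "lift ⇒ factorisation"; here via `exists_dual_multiplier`, with
`U i := A (xs i, y i) + B` a feasible lift of `xs i` and `V k` the dual multiplier of `ls k`). -/
theorem stub_shadowSlackFactor :
    ∀ (n m : ℕ) (K : Set (Fin n → ℝ)), IsSpectrahedralShadowOfSize K m → (0 : Fin n → ℝ) ∈ K →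
      ∀ (ι κ : Type) (xs : ι → Fin n → ℝ) (ls : κ → (Fin n → ℝ) →ₗ[ℝ] ℝ),
        (∀ i, xs i ∈ K) → (∀ k, ∀ x ∈ K, 0 ≤ ls k x) →
        ∃ (U : ι → Matrix (Fin m) (Fin m) ℝ) (V : κ → Matrix (Fin m) (Fin m) ℝ),
          (∀ i, (U i).PosSemidef) ∧ (∀ k, (V k).PosSemidef) ∧
          ∀ i k, ls k (xs i) = Matrix.trace (U i * V k) := by
  intro n m K hK h0 ι κ xs ls hxs hls
  obtain ⟨p, A, B, hrep⟩ := hK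
  have hfeas : ∀ x ∈ K, ∃ y : Fin p → ℝ, (A (x, y) + B).PosSemidef := fun x hx => (hrep x).1 hx
  choose y hy using fun i => hfeas (xs i) (hxs i)
  obtain ⟨y₀, hy₀⟩ := hfeas 0 h0
  have hmult : ∀ k, ∃ Λ : Matrix (Fin m) (Fin m) ℝ, Λ.PosSemidef ∧
      ∀ v : (Fin n → ℝ) × (Fin p → ℝ), (A v + B).PosSemidef →
        ls k v.1 = Matrix.trace ((A v + B) * Λ) := by
    intro k
    have hφ : ∀ v : (Fin n → ℝ) × (Fin p → ℝ), (A v + B).PosSemidef →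
        0 ≤ ((ls k).comp (LinearMap.fst ℝ (Fin n → ℝ) (Fin p → ℝ))) v :=
      fun v hv => hls k v.1 ((hrep v.1).2 ⟨v.2, hv⟩)
    have hφ₀ : ((ls k).comp (LinearMap.fst ℝ (Fin n → ℝ) (Fin p → ℝ))) ((0 : Fin n → ℝ), y₀) = 0 := by
      simp
    obtain ⟨Λ, hΛ, hΛeq⟩ := exists_dual_multiplier A B _ hφ hy₀ hφ₀
    exact ⟨Λ, hΛ, fun v hv => hΛeq v hv⟩
  choose Λ hΛpsd hΛeq using hmult
  exact ⟨fun i => A (xs i, y i) + B, Λ, fun i => hy i, hΛpsd, fun i k => hΛeq k (xs i, y i) (hy i)⟩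

end Summit.ValiantsHypothesis.ValiantsHypothesis.Theorems.PermanentalConesPermanentalConeHard
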